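/-
Copyright: the m5 harness (cell B2b-5 `b2b-lgcu-borel`, generation 21).  Sorry-free; axioms: propext,
Classical.choice, Quot.sound.  VALUE = THEOREM (a TPP-aware dual certificate on the level-one slice
involving all three members at once), NOT summit progress: the crux `SubgroupIdentityDesigns` is
untouched.
-/
import Mathlib
import Summits.MatrixMultiplication.MatrixMultiplication.Theorems.SubgroupIdentityDesigns.Negative.PackingBridge
import Summits.MatrixMultiplication.MatrixMultiplication.Theorems.SubgroupIdentityDesigns.Negative.VectorTransportSpan
import Summits.MatrixMultiplication.MatrixMultiplication.Theorems.SubgroupIdentityDesigns.Negative.LevelOneEquivariantDim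

/-!
# The product-character obstruction (level one, all three members jointly)

Let `(H₁, H₂, H₃)` satisfy the subgroup TPP in `GL_m(𝔽_p)` and carry a level-one identity test
`f ∈ F_1` (`f(1) = 1`, `f(abc) = 0` for `a ∈ H₁, b ∈ H₂, c ∈ H₃` with `abc ≠ 1`).  For characters
`σᵢ : Hᵢ → ℂˣ` consider the PRODUCT-CHARACTER FUNCTIONAL
`Λ_σ(φ) = Σ_{a ∈ H₁, b ∈ H₂, c ∈ H₃} σ₁(a) σ₂(b) σ₃(c) φ(abc)`.
By the TPP, `abc = 1` only for `a = b = c = 1`, so `Λ_σ(f) = 1` (`prodFun_test`).  Since `F_1` is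
spanned by the vector transports `t_{u,v} : g ↦ [g u = v]` (`levelSubmodule_le_of_transport`), some
transport has `Λ_σ(t_{u,v}) ≠ 0`:

* `exists_transport_prodFun_ne_zero` — **for every triple of characters there are vectors `u, v`
  with `Σ_{a,b,c} σ₁(a) σ₂(b) σ₃(c) [abc·u = v] ≠ 0`**; equivalently the operator
  `A₁ A₂ A₃ ≠ 0` on `ℂ[𝔽_p^m]`, `Aᵢ = Σ_{h ∈ Hᵢ} σᵢ(h) h`;
* `no_design_of_certificate` — contrapositive, in the notation of the crux at level `k = 1`: a
  triple of characters all of whose twisted triple transport sums vanish is a CERTIFICATE that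
  `(H₁, H₂, H₃)` carries no level-one identity design — for every `p`, `m` and exponent `ε`.

SUPPORT CERTIFICATES (`triple_sum_eq_zero`, `no_design_of_separated`).  Write
`adm(H, σ) = {w : σ = 1 on H_w}` for the `σ`-admissible vectors (`LevelOneEquivariantDim.adm`; it
is `H`-stable, and all of `𝔽_p^m` for `σ = 1`).  A twisted sum `Σ_{h ∈ H} σ(h) G(h·w)` vanishes
when `w ∉ adm(H, σ)` (`twisted_sum_eq_zero`: substitute `h ↦ hk` for a stabiliser element `k` with
`σ(k) ≠ 1`).  Peeling the triple sum from the right (`c`, then `b`, then `a`) gives: if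
`adm(H₁, σ₁) ∩ H₂·(adm(H₂, σ₂) ∩ adm(H₃, σ₃)) = ∅`, all twisted triple transport sums vanish, so
**a subgroup-TPP triple with `adm(H₁,σ₁) ∩ H₂·(adm(H₂,σ₂) ∩ adm(H₃,σ₃)) = ∅ for some characters
carries no level-one identity design** (`no_design_of_separated`).  Specialisations:
`no_design_of_disjoint₁₂` (`adm(H₁,σ₁) ∩ adm(H₂,σ₂) = ∅`), `no_design_of_disjoint₂₃`
(`adm(H₂,σ₂) ∩ adm(H₃,σ₃) = ∅`), `no_design_of_separated₁₃` (`adm(H₁,σ₁) ∩ H₂·adm(H₃,σ₃) = ∅`),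
and with two trivial characters the single-member ADMISSIBILITY PRINCIPLE `adm(Hᵢ, σᵢ) ≠ ∅`
(`AdmissibilityPrinciple.member_one_le_card_admOrb`).  The 2-member criteria are NEW: two members
may each have admissible vectors for their characters and still be jointly excluded when the
admissible sets do not meet — a constraint invisible to order counting and to the single-member
laws.  Every `p`, `m`, exponent `ε`; the TPP enters only through `abc = 1 ⇒ a = b = c = 1`.

This is the dual certificate of the design problem restricted to pure tensors of LINEAR characters
of `H₁ × H₂ × H₃` (for abelian members these span all of `ℂ^{H₁ × H₂ × H₃}`, so every dual
certificate is then a linear COMBINATION of such tensors; a single pure tensor need not suffice, and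
the pure-tensor criterion alone is not claimed to be complete).  It contains the single-member ADMISSIBILITY PRINCIPLE (`AdmissibilityPrinciple`):
with `σ₂ = σ₃ = 1` the sum is `Σ_{b,c} Σ_{a : a w = v} σ₁(a)` (`w = bcu`), and each inner sum runs
over a coset of the stabiliser `(H₁)_w`, hence vanishes when `σ₁` is non-trivial on every
stabiliser (no `σ₁`-admissible vector).  The genuinely 3-member content is the case where every
`Aᵢ ≠ 0` but the product vanishes.  Honest scope: no instance beyond the single-member ones is
computed here (no candidate triples are known in the open region); the theorems record the
certificate format and its support form for the successor's searches
(`run/shared/lean/b2b/levelgraded-cu/ORACLE-g21.md` §G21-11).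
-/

noncomputable section

open scoped BigOperators Classical Matrix

namespace Summit.MatrixMultiplication.MatrixMultiplication.Theorems.SubgroupIdentityDesigns.Negative
namespace ProductObstruction

open Literature.Barriers.MatrixMultiplication (SubgroupTPP)
open Summit.MatrixMultiplication.MatrixMultiplication.Theorems.LieRankDesigns.Negative (GLm Mat)
open Summit.MatrixMultiplication.MatrixMultiplication.Theorems.LevelOneGL2Designs.Negative
open PackingBridge (exists_test)
open VectorTransportSpan (levelSubmodule_le_of_transport)
open LevelOneEquivariantDim (adm mem_adm smul_mem_adm)

variable {p m : ℕ} [hp : Fact p.Prime]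

/-- The product-character functional `Λ_σ(φ) = Σ_{(a,b,c) ∈ H₁ × H₂ × H₃} σ₁(a)σ₂(b)σ₃(c) φ(abc)`. -/
def prodFun (H₁ H₂ H₃ : Subgroup (GLm p m)) (σ₁ : H₁ →* ℂˣ) (σ₂ : H₂ →* ℂˣ) (σ₃ : H₃ →* ℂˣ) :
    (GLm p m → ℂ) →ₗ[ℂ] ℂ where
  toFun φ := ∑ t : H₁ × H₂ × H₃,
    ((σ₁ t.1 : ℂˣ) : ℂ) * ((σ₂ t.2.1 : ℂˣ) : ℂ) * ((σ₃ t.2.2 : ℂˣ) : ℂ) *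
      φ ((t.1 : GLm p m) * (t.2.1 : GLm p m) * (t.2.2 : GLm p m))
  map_add' φ ψ := by
    rw [← Finset.sum_add_distrib]
    refine Finset.sum_congr rfl fun t _ => ?_
    rw [Pi.add_apply, mul_add]
  map_smul' r φ := by
    rw [RingHom.id_apply, smul_eq_mul, Finset.mul_sum]
    refine Finset.sum_congr rfl fun t _ => ?_
    rw [Pi.smul_apply, smul_eq_mul]
    ring

/-- Unfolding `prodFun`. -/
theorem prodFun_apply {H₁ H₂ H₃ : Subgroup (GLm p m)} (σ₁ : H₁ →* ℂˣ) (σ₂ : H₂ →* ℂˣ)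
    (σ₃ : H₃ →* ℂˣ) (φ : GLm p m → ℂ) :
    prodFun H₁ H₂ H₃ σ₁ σ₂ σ₃ φ = ∑ t : H₁ × H₂ × H₃,
      ((σ₁ t.1 : ℂˣ) : ℂ) * ((σ₂ t.2.1 : ℂˣ) : ℂ) * ((σ₃ t.2.2 : ℂˣ) : ℂ) *
        φ ((t.1 : GLm p m) * (t.2.1 : GLm p m) * (t.2.2 : GLm p m)) := rfl

/-- **The TPP evaluates the functional on a test**: `Λ_σ(f) = 1` — only `a = b = c = 1` has
`abc = 1`. -/
theorem prodFun_test {H₁ H₂ H₃ : Subgroup (GLm p m)} (htpp : SubgroupTPP H₁ H₂ H₃)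
    (σ₁ : H₁ →* ℂˣ) (σ₂ : H₂ →* ℂˣ) (σ₃ : H₃ →* ℂˣ) {f : GLm p m → ℂ} (h1 : f 1 = 1)
    (h0 : ∀ a ∈ H₁, ∀ b ∈ H₂, ∀ c ∈ H₃, a * b * c ≠ 1 → f (a * b * c) = 0) :
    prodFun H₁ H₂ H₃ σ₁ σ₂ σ₃ f = 1 := by
  rw [prodFun_apply, Fintype.sum_eq_single ((1 : H₁), (1 : H₂), (1 : H₃))]
  · simp [h1]
  · rintro ⟨a, b, c⟩ ht
    have hne : (a : GLm p m) * (b : GLm p m) * (c : GLm p m) ≠ 1 := by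
      intro h
      obtain ⟨ha, hb, hc⟩ := htpp a a.2 b b.2 c c.2 h
      exact ht (by ext <;> simp [ha, hb, hc])
    simp only [h0 a a.2 b b.2 c c.2 hne, mul_zero]

/-- **PRODUCT-CHARACTER OBSTRUCTION.**  Under the subgroup TPP and a level-one identity test, for
every triple of characters `σᵢ : Hᵢ → ℂˣ` some vector transport has a non-zero twisted triple sum:
`∃ u v, Σ_{a,b,c} σ₁(a)σ₂(b)σ₃(c) [abc·u = v] ≠ 0`. -/
theorem exists_transport_prodFun_ne_zero {H₁ H₂ H₃ : Subgroup (GLm p m)}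
    (htpp : SubgroupTPP H₁ H₂ H₃) {f : GLm p m → ℂ} (hf : f ∈ levelSubmodule p m 1)
    (h1 : f 1 = 1) (h0 : ∀ a ∈ H₁, ∀ b ∈ H₂, ∀ c ∈ H₃, a * b * c ≠ 1 → f (a * b * c) = 0)
    (σ₁ : H₁ →* ℂˣ) (σ₂ : H₂ →* ℂˣ) (σ₃ : H₃ →* ℂˣ) :
    ∃ u v : Fin m → ZMod p, (∑ t : H₁ × H₂ × H₃,
      ((σ₁ t.1 : ℂˣ) : ℂ) * ((σ₂ t.2.1 : ℂˣ) : ℂ) * ((σ₃ t.2.2 : ℂˣ) : ℂ) *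
        (if (((t.1 : GLm p m) * (t.2.1 : GLm p m) * (t.2.2 : GLm p m) : GLm p m) : Mat p m) *ᵥ u
          = v then (1 : ℂ) else 0)) ≠ 0 := by
  by_contra h
  push Not at h
  have hle : levelSubmodule p m 1 ≤ LinearMap.ker (prodFun H₁ H₂ H₃ σ₁ σ₂ σ₃) :=
    levelSubmodule_le_of_transport fun u v => by
      rw [LinearMap.mem_ker, prodFun_apply]
      exact h u v
  have hker := hle hf
  rw [LinearMap.mem_ker, prodFun_test htpp σ₁ σ₂ σ₃ h1 h0] at hker
  exact one_ne_zero hker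

/-- **Certificate form** (notation of `SubgroupIdentityDesigns`, level `k = 1`): if some triple of
characters has ALL twisted triple transport sums equal to zero, then the subgroup-TPP triple
`(H₁, H₂, H₃)` carries no level-one identity design — every `p`, `m`, exponent. -/
theorem no_design_of_certificate {H₁ H₂ H₃ : Subgroup (GLm p m)} (htpp : SubgroupTPP H₁ H₂ H₃)
    (σ₁ : H₁ →* ℂˣ) (σ₂ : H₂ →* ℂˣ) (σ₃ : H₃ →* ℂˣ)
    (hcert : ∀ u v : Fin m → ZMod p, (∑ t : H₁ × H₂ × H₃,
      ((σ₁ t.1 : ℂˣ) : ℂ) * ((σ₂ t.2.1 : ℂˣ) : ℂ) * ((σ₃ t.2.2 : ℂˣ) : ℂ) *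
        (if (((t.1 : GLm p m) * (t.2.1 : GLm p m) * (t.2.2 : GLm p m) : GLm p m) : Mat p m) *ᵥ u
          = v then (1 : ℂ) else 0)) = 0) :
    ¬ ∃ c : Mat p m → ℂ, (∀ M, 1 < M.rank → c M = 0) ∧
      (∑ M, c M * ZMod.stdAddChar (Matrix.trace (M * ((1 : GLm p m) : Mat p m)))) = 1 ∧
      ∀ a ∈ H₁, ∀ b ∈ H₂, ∀ g ∈ H₃, a * b * g ≠ 1 →
        (∑ M, c M * ZMod.stdAddChar (Matrix.trace (M * ((a * b * g : GLm p m) : Mat p m)))) = 0 := by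
  intro hdes
  obtain ⟨f, hf, h1, h0⟩ := exists_test hdes
  obtain ⟨u, v, huv⟩ := exists_transport_prodFun_ne_zero htpp hf h1 h0 σ₁ σ₂ σ₃
  exact huv (hcert u v)

section Support

/-- **Twisted stabiliser sums vanish off the admissible set**: if `w ∉ adm(H, σ)` then
`Σ_{h ∈ H} σ(h) G(h·w) = 0` for every `G` (substitute `h ↦ hk`, `k ∈ H_w`, `σ(k) ≠ 1`). -/
theorem twisted_sum_eq_zero {H : Subgroup (GLm p m)} (σ : H →* ℂˣ)
    (G : (Fin m → ZMod p) → ℂ) {w : Fin m → ZMod p} (hw : w ∉ adm H σ) :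
    ∑ h : H, ((σ h : ℂˣ) : ℂ) * G (h • w) = 0 := by
  obtain ⟨k, hk, hσ⟩ : ∃ k : H, k • w = w ∧ σ k ≠ 1 := by
    by_contra hcon
    push Not at hcon
    exact hw fun k hk' => hcon k hk'
  set S := ∑ h : H, ((σ h : ℂˣ) : ℂ) * G (h • w) with hS
  have hre : ∑ h : H, ((σ (h * k) : ℂˣ) : ℂ) * G ((h * k) • w) = S :=
    Fintype.sum_equiv (Equiv.mulRight k) _ _ fun h => rfl
  have hmul : ∑ h : H, ((σ (h * k) : ℂˣ) : ℂ) * G ((h * k) • w) = ((σ k : ℂˣ) : ℂ) * S := by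
    rw [hS, Finset.mul_sum]
    refine Finset.sum_congr rfl fun h _ => ?_
    rw [map_mul, mul_smul, hk, Units.val_mul]
    ring
  have hk1 : ((σ k : ℂˣ) : ℂ) ≠ 1 := fun h => hσ (Units.val_eq_one.mp h)
  have h : (((σ k : ℂˣ) : ℂ) - 1) * S = 0 := by rw [sub_mul, one_mul, ← hmul, hre, sub_self]
  rcases mul_eq_zero.mp h with h | h
  · exact absurd (sub_eq_zero.mp h) hk1
  · exact h

/-- The triple sum over `H₁ × H₂ × H₃` as an iterated sum, `c` outermost. -/
theorem sum_prod_eq_iter {H₁ H₂ H₃ : Subgroup (GLm p m)} (F : H₁ → H₂ → H₃ → ℂ) :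
    ∑ t : H₁ × H₂ × H₃, F t.1 t.2.1 t.2.2 = ∑ c : H₃, ∑ b : H₂, ∑ a : H₁, F a b c := by
  rw [Fintype.sum_prod_type]
  simp_rw [Fintype.sum_prod_type]
  rw [Finset.sum_comm]
  conv_rhs => rw [Finset.sum_comm]
  exact Finset.sum_congr rfl fun b _ => Finset.sum_comm

/-- **Support certificate.**  If `adm(H₁,σ₁) ∩ H₂·(adm(H₂,σ₂) ∩ adm(H₃,σ₃)) = ∅`, every twisted
triple transport sum vanishes. -/
theorem triple_sum_eq_zero {H₁ H₂ H₃ : Subgroup (GLm p m)} (σ₁ : H₁ →* ℂˣ) (σ₂ : H₂ →* ℂˣ)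
    (σ₃ : H₃ →* ℂˣ)
    (hsep : ∀ w : Fin m → ZMod p, w ∈ adm H₂ σ₂ → w ∈ adm H₃ σ₃ → ∀ b : H₂, b • w ∉ adm H₁ σ₁)
    (u v : Fin m → ZMod p) :
    (∑ t : H₁ × H₂ × H₃,
      ((σ₁ t.1 : ℂˣ) : ℂ) * ((σ₂ t.2.1 : ℂˣ) : ℂ) * ((σ₃ t.2.2 : ℂˣ) : ℂ) *
        (if (((t.1 : GLm p m) * (t.2.1 : GLm p m) * (t.2.2 : GLm p m) : GLm p m) : Mat p m) *ᵥ u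
          = v then (1 : ℂ) else 0)) = 0 := by
  -- the indicator as a function of the moved vector
  let T : (Fin m → ZMod p) → ℂ := fun w => if w = v then 1 else 0
  have hT : ∀ (a : H₁) (b : H₂) (c : H₃),
      (if (((a : GLm p m) * (b : GLm p m) * (c : GLm p m) : GLm p m) : Mat p m) *ᵥ u = v
        then (1 : ℂ) else 0) = T (a • b • c • u) := by
    intro a b c
    show (if (((a : GLm p m) * (b : GLm p m) * (c : GLm p m) : GLm p m) : Mat p m) *ᵥ u = v
        then (1 : ℂ) else 0) =
      if ((a : GLm p m) : Mat p m) *ᵥ (((b : GLm p m) : Mat p m) *ᵥ (((c : GLm p m) : Mat p m) *ᵥ u))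
        = v then 1 else 0
    rw [Matrix.GeneralLinearGroup.coe_mul, Matrix.GeneralLinearGroup.coe_mul,
      ← Matrix.mulVec_mulVec, ← Matrix.mulVec_mulVec]
  have hrw : (∑ t : H₁ × H₂ × H₃,
      ((σ₁ t.1 : ℂˣ) : ℂ) * ((σ₂ t.2.1 : ℂˣ) : ℂ) * ((σ₃ t.2.2 : ℂˣ) : ℂ) *
        (if (((t.1 : GLm p m) * (t.2.1 : GLm p m) * (t.2.2 : GLm p m) : GLm p m) : Mat p m) *ᵥ u
          = v then (1 : ℂ) else 0)) =
      ∑ c : H₃, ((σ₃ c : ℂˣ) : ℂ) * ∑ b : H₂, ((σ₂ b : ℂˣ) : ℂ) *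
        ∑ a : H₁, ((σ₁ a : ℂˣ) : ℂ) * T (a • b • c • u) := by
    rw [sum_prod_eq_iter (fun a b c => ((σ₁ a : ℂˣ) : ℂ) * ((σ₂ b : ℂˣ) : ℂ) *
      ((σ₃ c : ℂˣ) : ℂ) * (if (((a : GLm p m) * (b : GLm p m) * (c : GLm p m) : GLm p m) : Mat p m)
        *ᵥ u = v then (1 : ℂ) else 0))]
    refine Finset.sum_congr rfl fun c _ => ?_
    rw [Finset.mul_sum]
    refine Finset.sum_congr rfl fun b _ => ?_
    rw [Finset.mul_sum, Finset.mul_sum]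
    refine Finset.sum_congr rfl fun a _ => ?_
    rw [hT]
    ring
  rw [hrw]
  -- inner sums: `a` over `H₁` vanishes off `adm(H₁,σ₁)`, `b` over `H₂` off `adm(H₂,σ₂)`, …
  have h1 : ∀ w : Fin m → ZMod p, w ∉ adm H₁ σ₁ →
      ∑ a : H₁, ((σ₁ a : ℂˣ) : ℂ) * T (a • w) = 0 :=
    fun w hw => twisted_sum_eq_zero σ₁ T hw
  have h2 : ∀ w : Fin m → ZMod p, w ∈ adm H₃ σ₃ →
      ∑ b : H₂, ((σ₂ b : ℂˣ) : ℂ) * ∑ a : H₁, ((σ₁ a : ℂˣ) : ℂ) * T (a • b • w) = 0 := by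
    intro w hw3
    by_cases hw2 : w ∈ adm H₂ σ₂
    · refine Finset.sum_eq_zero fun b _ => ?_
      rw [h1 (b • w) (hsep w hw2 hw3 b), mul_zero]
    · exact twisted_sum_eq_zero σ₂ (fun w' => ∑ a : H₁, ((σ₁ a : ℂˣ) : ℂ) * T (a • w')) hw2
  by_cases hu : u ∈ adm H₃ σ₃
  · refine Finset.sum_eq_zero fun c _ => ?_
    rw [h2 (c • u) (smul_mem_adm H₃ σ₃ c hu), mul_zero]
  · exact twisted_sum_eq_zero σ₃
      (fun w => ∑ b : H₂, ((σ₂ b : ℂˣ) : ℂ) * ∑ a : H₁, ((σ₁ a : ℂˣ) : ℂ) * T (a • b • w)) hu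

/-- **SEPARATION EXCLUSION.**  A subgroup-TPP triple with characters `σᵢ` such that
`adm(H₁,σ₁) ∩ H₂·(adm(H₂,σ₂) ∩ adm(H₃,σ₃)) = ∅` carries no level-one identity design. -/
theorem no_design_of_separated {H₁ H₂ H₃ : Subgroup (GLm p m)} (htpp : SubgroupTPP H₁ H₂ H₃)
    (σ₁ : H₁ →* ℂˣ) (σ₂ : H₂ →* ℂˣ) (σ₃ : H₃ →* ℂˣ)
    (hsep : ∀ w : Fin m → ZMod p, w ∈ adm H₂ σ₂ → w ∈ adm H₃ σ₃ → ∀ b : H₂, b • w ∉ adm H₁ σ₁) :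
    ¬ ∃ c : Mat p m → ℂ, (∀ M, 1 < M.rank → c M = 0) ∧
      (∑ M, c M * ZMod.stdAddChar (Matrix.trace (M * ((1 : GLm p m) : Mat p m)))) = 1 ∧
      ∀ a ∈ H₁, ∀ b ∈ H₂, ∀ g ∈ H₃, a * b * g ≠ 1 →
        (∑ M, c M * ZMod.stdAddChar (Matrix.trace (M * ((a * b * g : GLm p m) : Mat p m)))) = 0 :=
  no_design_of_certificate htpp σ₁ σ₂ σ₃ (triple_sum_eq_zero σ₁ σ₂ σ₃ hsep)

/-- **Members 1–2**: disjoint admissible sets `adm(H₁,σ₁) ∩ adm(H₂,σ₂) = ∅` exclude a level-one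
design (take `σ₃ = 1`; `adm(H₂,σ₂)` is `H₂`-stable). -/
theorem no_design_of_disjoint₁₂ {H₁ H₂ H₃ : Subgroup (GLm p m)} (htpp : SubgroupTPP H₁ H₂ H₃)
    (σ₁ : H₁ →* ℂˣ) (σ₂ : H₂ →* ℂˣ) (hdisj : Disjoint (adm H₁ σ₁) (adm H₂ σ₂)) :
    ¬ ∃ c : Mat p m → ℂ, (∀ M, 1 < M.rank → c M = 0) ∧
      (∑ M, c M * ZMod.stdAddChar (Matrix.trace (M * ((1 : GLm p m) : Mat p m)))) = 1 ∧
      ∀ a ∈ H₁, ∀ b ∈ H₂, ∀ g ∈ H₃, a * b * g ≠ 1 →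
        (∑ M, c M * ZMod.stdAddChar (Matrix.trace (M * ((a * b * g : GLm p m) : Mat p m)))) = 0 :=
  no_design_of_separated htpp σ₁ σ₂ (1 : H₃ →* ℂˣ) fun _ hw2 _ b hb1 =>
    Set.disjoint_left.mp hdisj hb1 (smul_mem_adm H₂ σ₂ b hw2)

/-- **Members 2–3**: disjoint admissible sets `adm(H₂,σ₂) ∩ adm(H₃,σ₃) = ∅` exclude a level-one
design (take `σ₁ = 1`). -/
theorem no_design_of_disjoint₂₃ {H₁ H₂ H₃ : Subgroup (GLm p m)} (htpp : SubgroupTPP H₁ H₂ H₃)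
    (σ₂ : H₂ →* ℂˣ) (σ₃ : H₃ →* ℂˣ) (hdisj : Disjoint (adm H₂ σ₂) (adm H₃ σ₃)) :
    ¬ ∃ c : Mat p m → ℂ, (∀ M, 1 < M.rank → c M = 0) ∧
      (∑ M, c M * ZMod.stdAddChar (Matrix.trace (M * ((1 : GLm p m) : Mat p m)))) = 1 ∧
      ∀ a ∈ H₁, ∀ b ∈ H₂, ∀ g ∈ H₃, a * b * g ≠ 1 →
        (∑ M, c M * ZMod.stdAddChar (Matrix.trace (M * ((a * b * g : GLm p m) : Mat p m)))) = 0 :=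
  no_design_of_separated htpp (1 : H₁ →* ℂˣ) σ₂ σ₃ fun _ hw2 hw3 _ _ =>
    Set.disjoint_left.mp hdisj hw2 hw3

/-- **Members 1–3**: `adm(H₁,σ₁) ∩ H₂·adm(H₃,σ₃) = ∅` excludes a level-one design (take
`σ₂ = 1`). -/
theorem no_design_of_separated₁₃ {H₁ H₂ H₃ : Subgroup (GLm p m)} (htpp : SubgroupTPP H₁ H₂ H₃)
    (σ₁ : H₁ →* ℂˣ) (σ₃ : H₃ →* ℂˣ)
    (hsep : ∀ w : Fin m → ZMod p, w ∈ adm H₃ σ₃ → ∀ b : H₂, b • w ∉ adm H₁ σ₁) :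
    ¬ ∃ c : Mat p m → ℂ, (∀ M, 1 < M.rank → c M = 0) ∧
      (∑ M, c M * ZMod.stdAddChar (Matrix.trace (M * ((1 : GLm p m) : Mat p m)))) = 1 ∧
      ∀ a ∈ H₁, ∀ b ∈ H₂, ∀ g ∈ H₃, a * b * g ≠ 1 →
        (∑ M, c M * ZMod.stdAddChar (Matrix.trace (M * ((a * b * g : GLm p m) : Mat p m)))) = 0 :=
  no_design_of_separated htpp σ₁ (1 : H₂ →* ℂˣ) σ₃ fun w _ hw3 b => hsep w hw3 b

end Support

end ProductObstruction
end Summit.MatrixMultiplication.MatrixMultiplication.Theorems.SubgroupIdentityDesigns.Negative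

end
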